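import Summits.Ventures.YMGap.Conjectures.TubeStringTensionReduced
import Summits.Ventures.YMGap.FlowData.RectTubeFluxNonAnnihilation
import HarnessLib

/-!
# Venture YMGap — the positivity conjunct of the RECTANGULAR tube string-tension law is a THEOREM:
# `TubeStringTensionLawDim3Rect` reduces to the bare inequalities `E₁^{(μ)}(L₁×L₂; β) < L_μ · (−ln u(β))`
# (theorems only; the conjecture text is untouched)

HONEST FRAMING: venture file of the cell `pub-ymgap` (QuantumFields programme), track Y3.  Companion THEOREMS about the
typed conjecture `TubeStringTensionLawDim3Rect` of `Conjectures/TubeStringTension.lean` (item (12), commit 840feeed49aa;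
text of record NOT modified, R158), completing `Conjectures/TubeStringTensionReduced.lean` (the cubic laws): its first
conjunct `0 < su2RectSectorTop β Ls μ` is PROVED for every `β ≠ 0` by `FlowData/RectTubeFluxNonAnnihilation.lean`
(`su2_rectTubeSectorNorm_single_pos`), so
ALL THREE typed laws «L-Y3-σ» are equivalent to their bare finite-volume inequalities, and the torelon energies in
them are strictly positive.  Nothing here decides the conjectures; finite tori only; nothing about `L → ∞`, the
continuum, a string tension or a mass gap.

References: G. 't Hooft, Nucl. Phys. B 153 (1979) 141 [cite: tHooft1979Flux]; G. Münster, Nucl. Phys. B 180 (1981) 23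
[folklore].
-/

noncomputable section

open Summit.Ventures.YMGap.FlowData

namespace Summit.Ventures.YMGap.Conjectures

/-- **«L-Y3-σ» (rectangular twin) reduces to the bare inequalities**:
`TubeStringTensionLawDim3Rect ↔ ∀ Ls β > 0 μ, E₁^{(μ)}(ℤ/L₁ × ℤ/L₂; β) < L_μ · (−ln u(β))`. [folklore] -/
theorem tubeStringTensionLawDim3Rect_iff_energy :
    TubeStringTensionLawDim3Rect ↔ ∀ (Ls : Fin 2 → ℕ) [∀ i, NeZero (Ls i)] (β : ℝ), 0 < β → ∀ μ : Fin 2,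
      su2RectTorelonEnergy β Ls μ < (Ls μ : ℝ) * (-Real.log (su2CharacterRatio β)) :=
  ⟨fun h Ls _ β hβ μ => (h Ls β hβ μ).2, fun h Ls _ β hβ μ => ⟨su2_rectTubeSectorNorm_single_pos hβ.ne' Ls μ, h Ls β hβ μ⟩⟩

/-- **All three typed laws reduce to bare inequalities** (summary conjunction of the three equivalences).
[folklore] -/
theorem tubeStringTensionLaws_iff_energy :
    (TubeStringTensionLawDim3 ↔ ∀ (L : ℕ) [NeZero L] (β : ℝ), 0 < β →
        su2TorelonEnergy β 2 L 0 < (L : ℝ) * (-Real.log (su2CharacterRatio β))) ∧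
      (TubeStringTensionLawDim4 ↔ ∀ (L : ℕ) [NeZero L] (β : ℝ), 0 < β →
        su2TorelonEnergy β 3 L 0 < (L : ℝ) * (-Real.log (su2CharacterRatio β))) ∧
      (TubeStringTensionLawDim3Rect ↔ ∀ (Ls : Fin 2 → ℕ) [∀ i, NeZero (Ls i)] (β : ℝ), 0 < β → ∀ μ : Fin 2,
        su2RectTorelonEnergy β Ls μ < (Ls μ : ℝ) * (-Real.log (su2CharacterRatio β))) :=
  ⟨tubeStringTensionLawDim3_iff_energy, tubeStringTensionLawDim4_iff_energy, tubeStringTensionLawDim3Rect_iff_energy⟩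

/-- **The rectangular torelon energies are strictly positive** for `β > 0` (hypothesis-free), as is the threshold
`L_μ · (−ln u(β))`. [folklore] -/
theorem su2RectTorelonEnergy_pos_and_threshold_pos {k : ℕ} {β : ℝ} (hβ : 0 < β) (Ls : Fin k → ℕ) [∀ i, NeZero (Ls i)]
    (μ : Fin k) : 0 < su2RectTorelonEnergy β Ls μ ∧ 0 < (Ls μ : ℝ) * (-Real.log (su2CharacterRatio β)) := by
  refine ⟨su2RectTorelonEnergy_pos' hβ.ne' Ls μ, mul_pos (Nat.cast_pos.2 (Nat.pos_of_ne_zero (NeZero.ne (Ls μ)))) ?_⟩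
  haveI : NeZero (1 : ℕ) := ⟨one_ne_zero⟩
  have h := (su2TorelonEnergy_pos_and_threshold_pos hβ 1 1 0).2
  simpa only [Nat.cast_one, one_mul] using h

end Summit.Ventures.YMGap.Conjectures
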